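import Summits.ABC.IUTFork.Cor312PilotIdelesPrThetaSide
import Summits.ABC.IUTFork.Cor312PilotIdelesPrWitness
import Summits.ABC.IUTFork.Thm311ToCor312
import HarnessLib

/-!
# [IUTchIII] Cor. 3.12 at the print-normalised assembled real setting with pilot regions read off ideles —
# HONEST INCLUSION: every Kummer image of the Θ-pilot object lies INSIDE the q-pilot region, and IS the q-pilot region
# at label `1`, at `∞` and over the good primes (READING R3 holds there by the identity indeterminacy)

PROOF-ONLY record file (D-0012; no definitions, no `Prop` facts) of the abc-iut cell (WAVE-4 D-0067 discharge seat
abc-iut-w4-d036, gen 4; C312 cone piece(support); sequel to this seat's `Cor312PilotIdelesPrResidual` p430988, which proves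
`¬ READING R3` / `¬ PilotKummerIndRelated` at the same setting GLOBALLY; companion `Cor312PilotIdelesPrProfile` gives the
packet-by-packet profile). TAKES NO SIDE on [IUTchIII] Cor. 3.12.

SETTING. abc-iut-c312-7's `Real.settingPrVolSharp` (`Cor312PilotIdelesPr` p422627): the real Dupuy–Hilado-level log-shells of
the number field `F`, the probability-weighted verbatim volume container `summandPiecesPr`, abc-iut-c312-3's sharp Θ-boxes
`ι_j(t_{Θ,j,v_j})·(R_I)^∼` and `q`-centre `ψ(ι_j(t_{q,v_j}))` read off Θ-ideles `t` and `q`-ideles `tq`; "realising" =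
`log ‖t_{Θ,i+1,v}‖ = −P_{Θ,i+1}(v)·ln N(v)/n_v`, `log ‖t_{q,v}‖ = −P_q(v)·ln N(v)/n_v` (Dupuy–Hilado (3.4); `P_{Θ,j} = j²·P_q`,
[IUTchIII] Def. 3.8 (i): the Θ-pilot object is the `q̲^{j²}`-line bundle, the q-pilot object the `q̲`-line bundle).

CONTENTS (all at `settingPrVolSharp`; `j = i+1 ∈ 𝔽_l^⋇`):
* §2 `iota_smul_normalizedPacket_subset_of_norm_le_slot` — on a real tensor packet, `‖a‖ ≤ ‖b‖ ⇒ ι_i(a)·(R_I)^∼ ⊆ ι_i(b)·(R_I)^∼`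
  (`a = b·(a/b)`, `ι_i(𝒪) ⊆ R_I ⊆ (R_I)^∼`, a subring; [IUTchIV] Prop. 1.4 (i)); `…_eq_of_norm_eq_slot`.
* §1 packet forms: at a prime both pilot regions are `e⁻¹(Π_{v⃗} ι_j(a_{v_j})·(R_I)^∼)` with `a = t_{Θ,j,·}` resp. `t_{q,·}`
  (abc-iut-c312-3 `factorMap_preimage_boxOf` / `factorMap_preimage_hullSet_centreOf`); at `∞` both are the whole packet.
* §3 **`thetaRegion_subset_qRegion_settingPrVolSharp`** — `‖t_{Θ,j,v}‖ ≤ ‖t_{q,v}‖` for all `v` ⇒ EVERY Kummer image of the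
  Θ-pilot object lies in the q-pilot region at every `(j, v_ℚ)`; for realising ideles this hypothesis holds
  (`thetaIdele_norm_le_qIdele_norm_of_realises`: `‖t_{Θ,j,v}‖ = ‖t_{q,v}‖^{j²} ≤ ‖t_{q,v}‖`), whence
  **`thetaRegion_subset_qRegion_settingPrVolSharp_of_realises`** — the «repair fact» RF-J2 of plan/GAP-LEDGER G-rpj1-2 (and the
  set reading of `PinnedHonest`'s `hscaled`) is a THEOREM at the genuine data; `thetaRegion_eq_qRegion_settingPrVolSharp_of_norm_eq`
  — equality where the norms agree; hence READING R3 («the q-pilot region is a possible image of the Θ-pilot object») HOLDS at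
  `∞` (`…_inl`), at label `j = 1` (`…_of_label_one`) and over every prime with no bad place above it (`…_of_good`).
The companion profile file shows these are the ONLY packets where R3 holds (volumes `j²·(−|log(q)|_{j,p}) < −|log(q)|_{j,p}`
at `j ≥ 2` over the bad primes). [claim: Mochizuki2012, status: disputed] for the quoted sentences; [cite: ScholzeStix2018,
§2.2 pp. 9–10]; [cite: DupuyHilado2025, §3.3, §3.4, §3.7, §3.9, §4.10]; [cite: Mochizuki2012, IUTchIV Prop. 1.4 (i) p. 13].
HONEST FRAMING: nothing here asserts that abc or [IUTchIII] Cor. 3.12 is proved or refuted, nor that the sharp reading is the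
author's; the HULL-level reading (the printed Statement, `Thm311ToCor312.Licence`) is untouched; typed ≠ proved;
instantiated ≠ endorsed.
-/

noncomputable section

open Set Function NumberField IsDedekindDomain
open scoped Pointwise

namespace Summit.ABC

namespace IUTFork

namespace Thm311

namespace Real

open Cor312 Cor312.Setting Cor312Vol Literature.IUT.LogThetaLattice Literature.IUT.LogVolume

/-! ## §2. Same slot, nested translates of `(R_I)^∼` -/

/-- **`‖a‖ ≤ ‖b‖ ⇒ ι_i(a)·(R_I)^∼ ⊆ ι_i(b)·(R_I)^∼`** on the real tensor packet `⊗_{ℚ_p} k_i` (same slot `i`): `a = b·(a/b)` with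
`‖a/b‖ ≤ 1`, `ι_i(a/b) ∈ R_I ⊆ (R_I)^∼` (abc-iut-S8 `iota_mem_integerPacket`, abc-iut-S1 `integerPacket_le_normalizedPacket`) and
`(R_I)^∼` is a subring. (The cross-slot version through a decomposition `ψ` is abc-iut-c312-d1's
`iota_smul_normalizedPacket_subset_of_norm_le`.) [cite: Mochizuki2012, IUTchIV Prop. 1.4 (i) p. 13] -/
theorem iota_smul_normalizedPacket_subset_of_norm_le_slot (p : ℕ) [Fact p.Prime] {I : Type} [Fintype I] [DecidableEq I]
    (k : I → Type) [∀ i, NontriviallyNormedField (k i)] [∀ i, NormedAlgebra ℚ_[p] (k i)]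
    [∀ i, IsUltrametricDist (k i)] [∀ i, ProperSpace (k i)] (i : I) {a b : k i} (hb : b ≠ 0) (h : ‖a‖ ≤ ‖b‖) :
    iota p k i a • (normalizedPacket p k : Set (PacketAlgebra p k)) ⊆
      iota p k i b • (normalizedPacket p k : Set (PacketAlgebra p k)) := by
  rintro _ ⟨y, hy, rfl⟩
  have hc : ‖a / b‖ ≤ 1 := by
    rw [norm_div]
    exact div_le_one_of_le₀ h (norm_nonneg _)
  refine ⟨iota p k i (a / b) * y,
    mul_mem (integerPacket_le_normalizedPacket p k (iota_mem_integerPacket p k i hc)) hy, ?_⟩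
  have hab : b * (a / b) = a := by rw [← mul_div_assoc]; exact mul_div_cancel_left₀ a hb
  simp only [smul_eq_mul]
  rw [← mul_assoc, ← map_mul, hab]

/-- Equal norms, equal translates (same slot). [cite: Mochizuki2012, IUTchIV Prop. 1.4 (i) p. 13] -/
theorem iota_smul_normalizedPacket_eq_of_norm_eq_slot (p : ℕ) [Fact p.Prime] {I : Type} [Fintype I] [DecidableEq I]
    (k : I → Type) [∀ i, NontriviallyNormedField (k i)] [∀ i, NormedAlgebra ℚ_[p] (k i)]
    [∀ i, IsUltrametricDist (k i)] [∀ i, ProperSpace (k i)] (i : I) {a b : k i} (ha : a ≠ 0) (hb : b ≠ 0)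
    (h : ‖a‖ = ‖b‖) :
    iota p k i a • (normalizedPacket p k : Set (PacketAlgebra p k)) =
      iota p k i b • (normalizedPacket p k : Set (PacketAlgebra p k)) :=
  (iota_smul_normalizedPacket_subset_of_norm_le_slot p k i hb h.le).antisymm
    (iota_smul_normalizedPacket_subset_of_norm_le_slot p k i ha h.ge)

variable {F : Type} [Field F] [NumberField F] (X : PilotData F) {logv : PadicLogs F} (hlog : LogvAnalytic logv)
  (M : Type) [Field M] [NumberField M]
  (archPk : ∀ (j : (thetaIndex X).Label) (vQ : (thetaIndex X).VQ), Set ((logShellsDH X logv).Packet j vQ))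
  (archSub : ∀ (j : (thetaIndex X).Label) (v : (thetaIndex X).V),
    Set ((logShellsDH X logv).Packet j ((thetaIndex X).over v)))
  (Ψ : ℤ → ∀ v : (thetaIndex X).V, v ∈ (thetaIndex X).Vbad → Set ((logShellsDH X logv).StarPacket v))
  (act : ℤ → ∀ v : (thetaIndex X).V, v ∈ (thetaIndex X).Vbad →
    (logShellsDH X logv).StarPacket v → Module.End ℚ ((logShellsDH X logv).StarPacket v))
  (Mmod : ℤ → ∀ j : (thetaIndex X).LabelStar, Set ((logShellsDH X logv).GlobalPacket j.1))
  (region : ℤ → ∀ j : (thetaIndex X).LabelStar, FinDivisor M → ∀ vQ : (thetaIndex X).VQ,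
    Set ((logShellsDH X logv).Packet j.1 vQ))
  (n : ℤ) {HT : Type} {LogLink : HT → HT → Type} {IsFull : ∀ {s t : HT}, LogLink s t → Prop}
  (lat : LGPGaussianLogThetaLattice LogLink IsFull)
  {Frd : Type} {IsoF : Frd → Frd → Type} {Ob : Frd → Type} {realify : Frd → Frd} {Strip : Type}
  {IsoS : Strip → Strip → Type} {Mv : ∀ v : (thetaIndex X).V, v ∈ (thetaIndex X).Vbad → Type}
  [∀ v h, Monoid (Mv v h)]
  (sig : GlobalLGPFrobenioidSignature (thetaIndex X).lstar (thetaIndex X).V (· ∈ (thetaIndex X).Vbad)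
    Frd IsoF Ob realify Strip IsoS Mv)
  (split : SplittingMonoids Mv) {ObΔ : Type} {N : ∀ v : (thetaIndex X).V, v ∈ (thetaIndex X).Vbad → Type}
  [∀ v h, Monoid (N v h)] (qData : QPilotData ObΔ N)
  (t : ∀ (pp : Nat.Primes) (_ : Fin X.lstar) (x : (thetaIndex X).Fibre (.inr pp)),
    haveI : Fact (pp : ℕ).Prime := ⟨pp.2⟩; kOf X pp.1 x)
  (ht0 : ∀ pp i x, t pp i x ≠ 0)
  /- the Θ-ideles REALISE `P_Θ` in Dupuy–Hilado's normalisation (3.4) -/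
  (ht : ∀ (pp : Nat.Primes) (i : Fin X.lstar) (x : (thetaIndex X).Fibre (.inr pp)),
    haveI : Fact (pp : ℕ).Prime := ⟨pp.2⟩
    Real.log ‖t pp i x‖ = -(X.thetaPilot i (placeOf X pp.1 x)) * logNorm F (placeOf X pp.1 x) /
      localDegree F (placeOf X pp.1 x))
  (tq : ∀ (pp : Nat.Primes) (x : (thetaIndex X).Fibre (.inr pp)), haveI : Fact (pp : ℕ).Prime := ⟨pp.2⟩; kOf X pp.1 x)
  (htq0 : ∀ pp x, tq pp x ≠ 0)
  (htq1 : ∀ (pp : Nat.Primes) (x : (thetaIndex X).Fibre (.inr pp)),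
    haveI : Fact (pp : ℕ).Prime := ⟨pp.2⟩; placeOf X pp.1 x ∉ X.S → ‖tq pp x‖ = 1)
  /- the `q`-ideles REALISE `P_q` -/
  (htq : ∀ (pp : Nat.Primes) (x : (thetaIndex X).Fibre (.inr pp)),
    haveI : Fact (pp : ℕ).Prime := ⟨pp.2⟩
    Real.log ‖tq pp x‖ = -(X.qPilot (placeOf X pp.1 x)) * logNorm F (placeOf X pp.1 x) /
      localDegree F (placeOf X pp.1 x))

/-! ## §1. The two pilot regions packet by packet -/

/-- At a prime `p`, every Kummer image of the Θ-pilot object is `e⁻¹(Π_{v⃗} ι_j(t_{Θ,j,v_j})·(R_I)^∼)` (abc-iut-c312-3's sharp boxes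
pulled back through the comparison). [cite: DupuyHilado2025, §3.7, §4.10] -/
theorem thetaRegion_settingPrVolSharp_inr (m : ℤ) (j : (thetaIndex X).Label) (pp : Nat.Primes) :
    haveI : Fact (pp : ℕ).Prime := ⟨pp.2⟩
    (settingPrVolSharp X hlog M archPk archSub Ψ act Mmod region n lat sig split qData tq t htq0 htq1).thetaRegion m j
        (.inr pp) =
      (presAtPr X hlog pp).comparison j ⁻¹' Set.pi univ (sharpBoxDH X hlog t pp j) := by
  haveI : Fact (pp : ℕ).Prime := ⟨pp.2⟩
  exact (presAtPr X hlog pp).factorMap_preimage_boxOf (sharpBoxDH X hlog t pp j)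

/-- At a prime `p`, the q-pilot region is `e⁻¹(Π_{v⃗} ι_j(t_{q,v_j})·(R_I)^∼)` (the hull-set `λ_q·𝒪_L` of abc-iut-c312-3's `q`-centre
pulled back). [cite: DupuyHilado2025, §3.9] -/
theorem qRegion_settingPrVolSharp_inr (j : (thetaIndex X).Label) (pp : Nat.Primes) :
    haveI : Fact (pp : ℕ).Prime := ⟨pp.2⟩
    (settingPrVolSharp X hlog M archPk archSub Ψ act Mmod region n lat sig split qData tq t htq0 htq1).qRegion j (.inr pp) =
      (presAtPr X hlog pp).comparison j ⁻¹' Set.pi univ fun e =>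
        iota pp.1 ((presAtPr X hlog pp).kk e) (Fin.last _) (tq pp (e (Fin.last _))) •
          (normalizedPacket pp.1 ((presAtPr X hlog pp).kk e) : Set ((presAtPr X hlog pp).X e)) := by
  haveI : Fact (pp : ℕ).Prime := ⟨pp.2⟩
  exact (presAtPr X hlog pp).factorMap_preimage_hullSet_centreOf
    (fun e => iota pp.1 ((presAtPr X hlog pp).kk e) (Fin.last _) (tq pp (e (Fin.last _))))
    fun e i => dEquiv_iota_ne_zero pp.1 _ (Fin.last _) (htq0 pp _) i

/-- At `∞` every Kummer image of the Θ-pilot object is the whole packet (no field factor at `∞` in the Dupuy–Hilado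
containers of the parent files; the honest archimedean twin is `Thm311RealDegreeArch`). [folklore] -/
theorem thetaRegion_settingPrVolSharp_inl (m : ℤ) (j : (thetaIndex X).Label) (u : Unit) :
    (settingPrVolSharp X hlog M archPk archSub Ψ act Mmod region n lat sig split qData tq t htq0 htq1).thetaRegion m j
        (.inl u) = Set.univ := by
  show factorMapDH X hlog j (.inl u) ⁻¹' Set.univ = _
  exact Set.preimage_univ

/-- At `∞` the q-pilot region is the whole packet, too. [folklore] -/
theorem qRegion_settingPrVolSharp_inl (j : (thetaIndex X).Label) (u : Unit) :
    (settingPrVolSharp X hlog M archPk archSub Ψ act Mmod region n lat sig split qData tq t htq0 htq1).qRegion j (.inl u) =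
      Set.univ := by
  show factorMapDH X hlog j (.inl u) ⁻¹' hullSet (factorFieldDH X hlog j (.inl u)) (fun s => s.elim) = _
  refine Set.eq_univ_of_forall fun x => ?_
  rw [Set.mem_preimage, hullSet, mem_polydisc]
  exact fun s => s.elim

/-- The (Ind3)-enlarged region is the single (position-independent) image. [cite: DupuyHilado2025, §4.10] -/
theorem thetaRegion3_settingPrVolSharp_eq (m : ℤ) (j : (thetaIndex X).Label) (vQ : (thetaIndex X).VQ) :
    (settingPrVolSharp X hlog M archPk archSub Ψ act Mmod region n lat sig split qData tq t htq0 htq1).thetaRegion3 j vQ =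
      (settingPrVolSharp X hlog M archPk archSub Ψ act Mmod region n lat sig split qData tq t htq0 htq1).thetaRegion m j
        vQ := by
  ext x
  simp only [Setting.thetaRegion3, Set.mem_iUnion]
  exact ⟨fun ⟨_, hm⟩ => hm, fun hx => ⟨m, hx⟩⟩

/-! ## §3. Honest inclusion, and equality where the norms agree -/

/-- **HONEST INCLUSION at the genuine data**: if `‖t_{Θ,j,v}‖ ≤ ‖t_{q,v}‖` at every place (e.g. for realising ideles,
`thetaIdele_norm_le_qIdele_norm_of_realises`), EVERY Kummer image of the Θ-pilot object lies in the q-pilot region at every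
`(j, v_ℚ)`, `j ∈ 𝔽_l^⋇` — print's Θ-pilot `(q̲^{j²})_j` versus q-pilot `q̲` ([IUTchIII] Def. 3.8 (i), Rmk. 3.12.2 (ii)) read on
the regions; the repair fact RF-J2 (plan/GAP-LEDGER G-rpj1-2) as a THEOREM here. [claim: Mochizuki2012, status: disputed] -/
theorem thetaRegion_subset_qRegion_settingPrVolSharp
    (hle : ∀ (pp : Nat.Primes) (i : Fin X.lstar) (x : (thetaIndex X).Fibre (.inr pp)),
      haveI : Fact (pp : ℕ).Prime := ⟨pp.2⟩; ‖t pp i x‖ ≤ ‖tq pp x‖)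
    (m : ℤ) (i : Fin (thetaIndex X).lstar) (vQ : (thetaIndex X).VQ) :
    (settingPrVolSharp X hlog M archPk archSub Ψ act Mmod region n lat sig split qData tq t htq0 htq1).thetaRegion m
        (labelSucc i) vQ ⊆
      (settingPrVolSharp X hlog M archPk archSub Ψ act Mmod region n lat sig split qData tq t htq0 htq1).qRegion (labelSucc i)
        vQ := by
  cases vQ with
  | inl u =>
    rw [qRegion_settingPrVolSharp_inl]
    exact Set.subset_univ _
  | inr pp =>
    haveI : Fact (pp : ℕ).Prime := ⟨pp.2⟩
    rw [thetaRegion_settingPrVolSharp_inr, qRegion_settingPrVolSharp_inr]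
    refine Set.preimage_mono (Set.pi_mono fun e _ => ?_)
    show iota pp.1 ((presAtPr X hlog pp).kk e) (Fin.last _) (labelIdele X t pp (labelSucc i) (e (Fin.last _))) •
        (normalizedPacket pp.1 ((presAtPr X hlog pp).kk e) : Set ((presAtPr X hlog pp).X e)) ⊆ _
    rw [labelIdele_labelSucc]
    exact iota_smul_normalizedPacket_subset_of_norm_le_slot pp.1 _ (Fin.last _) (htq0 pp _) (hle pp i _)

include ht0 in
/-- Where `‖t_{Θ,j,v}‖ = ‖t_{q,v}‖` at every place over `p`, the Kummer images of the Θ-pilot object at `(j, p)` ARE the q-pilot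
region. [cite: DupuyHilado2025, §3.7, §3.9] -/
theorem thetaRegion_eq_qRegion_settingPrVolSharp_of_norm_eq (m : ℤ) (i : Fin (thetaIndex X).lstar) (pp : Nat.Primes)
    (heq : ∀ x : (thetaIndex X).Fibre (.inr pp), haveI : Fact (pp : ℕ).Prime := ⟨pp.2⟩; ‖t pp i x‖ = ‖tq pp x‖) :
    (settingPrVolSharp X hlog M archPk archSub Ψ act Mmod region n lat sig split qData tq t htq0 htq1).thetaRegion m
        (labelSucc i) (.inr pp) =
      (settingPrVolSharp X hlog M archPk archSub Ψ act Mmod region n lat sig split qData tq t htq0 htq1).qRegion (labelSucc i)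
        (.inr pp) := by
  haveI : Fact (pp : ℕ).Prime := ⟨pp.2⟩
  rw [thetaRegion_settingPrVolSharp_inr, qRegion_settingPrVolSharp_inr]
  congr 1
  refine Set.pi_congr rfl fun e _ => ?_
  show iota pp.1 ((presAtPr X hlog pp).kk e) (Fin.last _) (labelIdele X t pp (labelSucc i) (e (Fin.last _))) •
      (normalizedPacket pp.1 ((presAtPr X hlog pp).kk e) : Set ((presAtPr X hlog pp).X e)) = _
  rw [labelIdele_labelSucc]
  exact iota_smul_normalizedPacket_eq_of_norm_eq_slot pp.1 _ (Fin.last _) (ht0 pp i _) (htq0 pp _) (heq _)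

include ht0 in
/-- … hence there READING R3 holds at `(j, p)`: the q-pilot region IS a possible image of the Θ-pilot object (identity
indeterminacy on the (Ind3)-enlarged region). [claim: Mochizuki2012, status: disputed] -/
theorem qRegion_mem_possibleImages_settingPrVolSharp_of_norm_eq (i : Fin (thetaIndex X).lstar) (pp : Nat.Primes)
    (heq : ∀ x : (thetaIndex X).Fibre (.inr pp), haveI : Fact (pp : ℕ).Prime := ⟨pp.2⟩; ‖t pp i x‖ = ‖tq pp x‖) :
    (settingPrVolSharp X hlog M archPk archSub Ψ act Mmod region n lat sig split qData tq t htq0 htq1).qRegion (labelSucc i)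
        (.inr pp) ∈
      (settingPrVolSharp X hlog M archPk archSub Ψ act Mmod region n lat sig split qData tq t htq0 htq1).possibleImages
        (labelSucc i) (.inr pp) := by
  rw [← thetaRegion_eq_qRegion_settingPrVolSharp_of_norm_eq X hlog M archPk archSub Ψ act Mmod region n lat sig split qData
      t ht0 tq htq0 htq1 0 i pp heq,
    ← thetaRegion3_settingPrVolSharp_eq X hlog M archPk archSub Ψ act Mmod region n lat sig split qData t tq htq0 htq1 0]
  exact Setting.thetaRegion3_mem_possibleImages _ _ _

/-- At `∞` READING R3 holds trivially (both regions are the whole packet). [folklore] -/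
theorem qRegion_mem_possibleImages_settingPrVolSharp_inl (j : (thetaIndex X).Label) (u : Unit) :
    (settingPrVolSharp X hlog M archPk archSub Ψ act Mmod region n lat sig split qData tq t htq0 htq1).qRegion j (.inl u) ∈
      (settingPrVolSharp X hlog M archPk archSub Ψ act Mmod region n lat sig split qData tq t htq0 htq1).possibleImages j
        (.inl u) := by
  rw [qRegion_settingPrVolSharp_inl,
    ← thetaRegion_settingPrVolSharp_inl X hlog M archPk archSub Ψ act Mmod region n lat sig split qData t tq htq0 htq1 0 j u,
    ← thetaRegion3_settingPrVolSharp_eq X hlog M archPk archSub Ψ act Mmod region n lat sig split qData t tq htq0 htq1 0]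
  exact Setting.thetaRegion3_mem_possibleImages _ _ _

/-! ## §4. Norms and volumes for realising ideles -/

include ht htq in
/-- For realising ideles, `‖t_{Θ,j,v}‖ = ‖t_{q,v}‖^{j²}` in logarithms: `log ‖t_{Θ,i+1,v}‖ = (i+1)²·log ‖t_{q,v}‖`.
[cite: DupuyHilado2025, §3.3, §3.4] -/
theorem log_norm_thetaIdele_eq_of_realises (pp : Nat.Primes) (i : Fin X.lstar) (x : (thetaIndex X).Fibre (.inr pp)) :
    haveI : Fact (pp : ℕ).Prime := ⟨pp.2⟩
    Real.log ‖t pp i x‖ = (((i : ℕ) + 1 : ℝ) ^ 2) * Real.log ‖tq pp x‖ := by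
  haveI : Fact (pp : ℕ).Prime := ⟨pp.2⟩
  rw [ht pp i x, htq pp x, X.thetaPilot_eq_smul i, Finsupp.smul_apply, smul_eq_mul]
  ring

include ht0 ht htq0 htq in
/-- For realising ideles, `‖t_{Θ,j,v}‖ ≤ ‖t_{q,v}‖` (`‖t_{q,v}‖ ≤ 1` as `P_q ≥ 0`, and `j² ≥ 1`). [cite: DupuyHilado2025, §3.3, §3.4] -/
theorem thetaIdele_norm_le_qIdele_norm_of_realises (pp : Nat.Primes) (i : Fin X.lstar)
    (x : (thetaIndex X).Fibre (.inr pp)) :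
    haveI : Fact (pp : ℕ).Prime := ⟨pp.2⟩; ‖t pp i x‖ ≤ ‖tq pp x‖ := by
  haveI : Fact (pp : ℕ).Prime := ⟨pp.2⟩
  have hq0 : 0 < ‖tq pp x‖ := norm_pos_iff.mpr (htq0 pp x)
  have ht0' : 0 < ‖t pp i x‖ := norm_pos_iff.mpr (ht0 pp i x)
  rw [← Real.log_le_log_iff ht0' hq0, log_norm_thetaIdele_eq_of_realises X t ht tq htq pp i x]
  -- `log ‖t_q‖ ≤ 0` and `(i+1)² ≥ 1`
  have hlog : Real.log ‖tq pp x‖ ≤ 0 := by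
    rw [htq pp x]
    have h1 : 0 ≤ X.qPilot (placeOf X pp.1 x) := by
      by_cases hS : placeOf X pp.1 x ∈ X.S
      · rw [X.qPilot_apply_of_mem hS]
        exact div_nonneg (by exact_mod_cast (X.ordq_pos hS).le) X.two_mul_l_pos.le
      · rw [X.qPilot_apply_of_not_mem hS]
    have h2 : 0 < logNorm F (placeOf X pp.1 x) := logNorm_pos F _
    have h3 : (0 : ℝ) < localDegree F (placeOf X pp.1 x) := by exact_mod_cast localDegree_pos F _
    have : 0 ≤ X.qPilot (placeOf X pp.1 x) * logNorm F (placeOf X pp.1 x) / localDegree F (placeOf X pp.1 x) :=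
      div_nonneg (mul_nonneg h1 h2.le) h3.le
    rw [neg_mul, neg_div]
    linarith
  have hsq : (1 : ℝ) ≤ ((i : ℕ) + 1 : ℝ) ^ 2 := by
    have : (1 : ℝ) ≤ (i : ℕ) + 1 := by
      have : (0 : ℝ) ≤ (i : ℕ) := by positivity
      linarith
    nlinarith
  nlinarith

include ht0 ht htq0 htq in
/-- For realising ideles the norms agree at label `1`: `‖t_{Θ,1,v}‖ = ‖t_{q,v}‖` (`P_{Θ,1} = P_q`). [cite: DupuyHilado2025, §3.3] -/
theorem thetaIdele_norm_eq_qIdele_norm_of_realises_zero (pp : Nat.Primes) (i : Fin X.lstar) (hi : (i : ℕ) = 0)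
    (x : (thetaIndex X).Fibre (.inr pp)) :
    haveI : Fact (pp : ℕ).Prime := ⟨pp.2⟩; ‖t pp i x‖ = ‖tq pp x‖ := by
  haveI : Fact (pp : ℕ).Prime := ⟨pp.2⟩
  have h := log_norm_thetaIdele_eq_of_realises X t ht tq htq pp i x
  rw [hi, Nat.cast_zero, zero_add, one_pow, one_mul] at h
  exact Real.log_injOn_pos (norm_pos_iff.mpr (ht0 pp i x)) (norm_pos_iff.mpr (htq0 pp x)) h

include ht0 ht htq0 htq in
/-- For realising ideles the norms agree over the GOOD primes (both are `1`). [cite: DupuyHilado2025, §3.3, §3.4] -/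
theorem thetaIdele_norm_eq_qIdele_norm_of_realises_good (pp : Nat.Primes) (i : Fin X.lstar)
    (x : (thetaIndex X).Fibre (.inr pp)) (hx : haveI : Fact (pp : ℕ).Prime := ⟨pp.2⟩; placeOf X pp.1 x ∉ X.S) :
    haveI : Fact (pp : ℕ).Prime := ⟨pp.2⟩; ‖t pp i x‖ = ‖tq pp x‖ := by
  haveI : Fact (pp : ℕ).Prime := ⟨pp.2⟩
  rw [norm_eq_one_of_realises X t ht0 ht pp i x hx, qIdele_norm_eq_one_of_realises X tq htq0 htq pp x hx]

include ht0 ht htq0 htq in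
/-- **RF-J2 AT THE GENUINE DATA**: for ideles realising `P_Θ`, `P_q`, every Kummer image of the Θ-pilot object lies in the
q-pilot region at every `(j, v_ℚ)`, `j ∈ 𝔽_l^⋇`. [claim: Mochizuki2012, status: disputed] [cite: DupuyHilado2025, §3.3, §3.9] -/
theorem thetaRegion_subset_qRegion_settingPrVolSharp_of_realises (m : ℤ) (i : Fin (thetaIndex X).lstar)
    (vQ : (thetaIndex X).VQ) :
    (settingPrVolSharp X hlog M archPk archSub Ψ act Mmod region n lat sig split qData tq t htq0 htq1).thetaRegion m
        (labelSucc i) vQ ⊆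
      (settingPrVolSharp X hlog M archPk archSub Ψ act Mmod region n lat sig split qData tq t htq0 htq1).qRegion (labelSucc i)
        vQ :=
  thetaRegion_subset_qRegion_settingPrVolSharp X hlog M archPk archSub Ψ act Mmod region n lat sig split qData t tq htq0 htq1
    (fun pp i x => thetaIdele_norm_le_qIdele_norm_of_realises X t ht0 ht tq htq0 htq pp i x) m i vQ

include ht0 ht htq0 htq in
/-- **READING R3 HOLDS AT LABEL `1`** over every prime, for realising ideles (`P_{Θ,1} = P_q`: the Kummer images of the Θ-pilot
object at label `1` ARE the q-pilot region). [claim: Mochizuki2012, status: disputed] [cite: DupuyHilado2025, §3.3] -/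
theorem qRegion_mem_possibleImages_settingPrVolSharp_of_label_one (i : Fin (thetaIndex X).lstar) (hi : (i : ℕ) = 0)
    (pp : Nat.Primes) :
    (settingPrVolSharp X hlog M archPk archSub Ψ act Mmod region n lat sig split qData tq t htq0 htq1).qRegion (labelSucc i)
        (.inr pp) ∈
      (settingPrVolSharp X hlog M archPk archSub Ψ act Mmod region n lat sig split qData tq t htq0 htq1).possibleImages
        (labelSucc i) (.inr pp) :=
  qRegion_mem_possibleImages_settingPrVolSharp_of_norm_eq X hlog M archPk archSub Ψ act Mmod region n lat sig split qData t ht0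
    tq htq0 htq1 i pp fun x => thetaIdele_norm_eq_qIdele_norm_of_realises_zero X t ht0 ht tq htq0 htq pp i hi x

include ht0 ht htq0 htq in
/-- **READING R3 HOLDS OVER THE GOOD PRIMES** at every label, for realising ideles (all ideles are units there: both regions are
the unit box). [claim: Mochizuki2012, status: disputed] [cite: DupuyHilado2025, §3.3, §3.4] -/
theorem qRegion_mem_possibleImages_settingPrVolSharp_of_good (i : Fin (thetaIndex X).lstar) (pp : Nat.Primes)
    (hgood : ∀ v ∈ placesOver F pp, v ∉ X.S) :
    (settingPrVolSharp X hlog M archPk archSub Ψ act Mmod region n lat sig split qData tq t htq0 htq1).qRegion (labelSucc i)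
        (.inr pp) ∈
      (settingPrVolSharp X hlog M archPk archSub Ψ act Mmod region n lat sig split qData tq t htq0 htq1).possibleImages
        (labelSucc i) (.inr pp) :=
  haveI : Fact (pp : ℕ).Prime := ⟨pp.2⟩
  qRegion_mem_possibleImages_settingPrVolSharp_of_norm_eq X hlog M archPk archSub Ψ act Mmod region n lat sig split qData t ht0
    tq htq0 htq1 i pp
    fun x => thetaIdele_norm_eq_qIdele_norm_of_realises_good X t ht0 ht tq htq0 htq pp i x (hgood _ (placeOf_mem X pp.1 x))

end Real

end Thm311

end IUTFork

end Summit.ABC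

end
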